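import Summits.Ventures.PercRepro.Night2LocalD2R14SixZeroC
import Summits.Ventures.PercRepro.Night2LocalD2R14SixAssembly

/-!
# PercRepro — the six-element columns of R1₄ without a far preimage, part D: the cell `κ = 2` and the reduction
(night-2, gen 16)

* **`sum_r14W_col_le_of_card_six_of_two_coloops`**: at a six-element shadow set without a far preimage and with two
  coloops `z₁ ≠ z₂` of `S` other than `y`, the column of R1₄ is `≤ 1` (`≤ 2087/2100`; proofs/NIGHT-2-k1.md §7.1);
* **`shadowHall_six_four_of_six_columns_leOneColoop`**: THE (6,4) SHADOW ROW FOR EVERY FINITE MATROID modulo the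
  six-element columns without a far preimage and with at most one coloop of `S` besides `y` (§7.2–7.4 on paper).
-/

namespace PercRepro.Shadow

open Finset PerFlat ThmH

variable {α : Type*} [DecidableEq α] {M : Matroid α} [M.Finite]

open scoped Classical in
/-- The pair part with a member face `S ∖ {z₁}`, a second coloop `z₂` and no far preimage: at most `14/75`. -/
theorem sum_r14Pair_le_of_face_member {G : Finset α} (hG : G ∈ flatsQ M (4 + 1)) (hd : (gr M \ G).card = 2)
    (hsimple : ∀ e ∈ gr M, ∀ f ∈ gr M, e ≠ f → rkN M {e, f} = 2) {y : α} (hyG : y ∈ G)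
    (hyc : y ∉ clF M (G.erase y)) {S : Finset α} (hS : S ∈ shadowAt M (4 + 2) 4 (Uq M (4 + 2) 4) G)
    (h6 : S.card = 6) (hf : opFarPre M G S = ∅) {z₁ z₂ : α} (hz₁S : z₁ ∈ S) (hz₂S : z₂ ∈ S) (hz₁y : z₁ ≠ y)
    (hz₂y : z₂ ≠ y) (hz₁₂ : z₁ ≠ z₂) (hz₁ : z₁ ∉ clF M (S.erase z₁)) (hz₂ : z₂ ∉ clF M (S.erase z₂))
    (hm₁ : S.erase z₁ ∈ membersIn M (Uq M (4 + 2) 4) G) :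
    ∑ B ∈ pairPre M 4 G S, r14Pair M G B ≤ 14 / 75 := by
  have hp := card_pairPre_le_three_of_two_coloops hG hyG hyc hS h6 hz₁S hz₂S hz₁y hz₂y hz₁₂ hz₁ hz₂
  have hle : ∀ B ∈ pairPre M 4 G S, r14Pair M G B ≤ 2 / 25 :=
    fun B hB => r14Pair_le_of_three_le (three_le_card_sdiff_clF_of_noFar hf hB)
  rcases Nat.lt_or_ge (pairPre M 4 G S).card 3 with h2 | h3
  · calc ∑ B ∈ pairPre M 4 G S, r14Pair M G B ≤ ∑ _B ∈ pairPre M 4 G S, (2 : ℚ) / 25 := Finset.sum_le_sum hle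
      _ = ((pairPre M 4 G S).card : ℚ) * (2 / 25) := by rw [Finset.sum_const, nsmul_eq_mul]
      _ ≤ 2 * (2 / 25) := by
          have : ((pairPre M 4 G S).card : ℚ) ≤ 2 := by exact_mod_cast (by omega : (pairPre M 4 G S).card ≤ 2)
          nlinarith
      _ ≤ 14 / 75 := by norm_num
  · have h3' : (pairPre M 4 G S).card = 3 := by omega
    obtain ⟨a, b, c, hab, hac, hbc, habc⟩ := Finset.card_eq_three.1 h3'
    have ha : a ∈ pairPre M 4 G S := by rw [habc]; simp
    have hb : b ∈ pairPre M 4 G S := by rw [habc]; simp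
    have hc : c ∈ pairPre M 4 G S := by rw [habc]; simp
    rw [habc, Finset.sum_insert (by simp [hab, hac]), Finset.sum_insert (by simp [hbc]), Finset.sum_singleton]
    have hnot : ¬ ((G \ clF M a).card = 3 ∧ (G \ clF M b).card = 3 ∧ (G \ clF M c).card = 3) := by
      rintro ⟨h1, h2, h3⟩
      exact not_three_pairs_of_three' hG hd hsimple hyG hyc hS hz₁S hz₂S hz₁y hz₂y hz₁₂ hm₁ hz₂ ha hb hc hab hac hbc
        h1 h2 h3
    have ha3 := three_le_card_sdiff_clF_of_noFar hf ha
    have hb3 := three_le_card_sdiff_clF_of_noFar hf hb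
    have hla := hle a ha
    have hlb := hle b hb
    have hlc := hle c hc
    by_cases h1 : (G \ clF M a).card = 3
    · by_cases h2 : (G \ clF M b).card = 3
      · have h3 : 4 ≤ (G \ clF M c).card := by
          by_contra h
          exact hnot ⟨h1, h2, by have := three_le_card_sdiff_clF_of_noFar hf hc; omega⟩
        have := r14Pair_le_of_four_le h3
        linarith
      · have := r14Pair_le_of_four_le (show 4 ≤ (G \ clF M b).card by omega)
        linarith
    · have := r14Pair_le_of_four_le (show 4 ≤ (G \ clF M a).card by omega)
      linarith

open scoped Classical in
/-- **The column of R1₄ at a six-element shadow set without a far preimage and with two coloops `z₁ ≠ z₂` of `S`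
(other than `y`) is `≤ 1`.** -/
theorem sum_r14W_col_le_of_card_six_of_two_coloops {G : Finset α} (hG : G ∈ flatsQ M (4 + 1))
    (hd : (gr M \ G).card = 2) (hsimple : ∀ e ∈ gr M, ∀ f ∈ gr M, e ≠ f → rkN M {e, f} = 2) {y : α}
    (hyG : y ∈ G) (hyc : y ∉ clF M (G.erase y)) (hP : ∀ z ∈ G.erase y, 4 ≤ rkN M ((G.erase y).erase z))
    {S : Finset α} (hS : S ∈ shadowAt M (4 + 2) 4 (Uq M (4 + 2) 4) G) (h6 : S.card = 6)
    (hf : opFarPre M G S = ∅) {z₁ z₂ : α} (hz₁S : z₁ ∈ S) (hz₂S : z₂ ∈ S) (hz₁y : z₁ ≠ y) (hz₂y : z₂ ≠ y)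
    (hz₁₂ : z₁ ≠ z₂) (hz₁ : z₁ ∉ clF M (S.erase z₁)) (hz₂ : z₂ ∉ clF M (S.erase z₂)) :
    ∑ B ∈ membersIn M (Uq M (4 + 2) 4) G, r14W M G B S ≤ 1 := by
  have hparts := sum_r14W_col_le_parts (M := M) G S
  rw [r14KeepPre_eq_empty (by omega), Finset.sum_empty, r14PairPre_eq_pairPre] at hparts
  have hcov : ∑ B ∈ r14CovPre M G S, r14Cov M G B ≤ ((r14CovPre M G S).card : ℚ) * (6 / 35) := by
    rw [← nsmul_eq_mul, ← Finset.sum_const]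
    exact Finset.sum_le_sum (fun B _ => r14Cov_le G B)
  have hc2 : ((r14CovPre M G S).card : ℚ) ≤ 2 := by
    exact_mod_cast card_r14CovPre_le_two_six hG hsimple hyG hyc hS (le_of_eq h6.symm)
  have hspread := r14Spread_le_six hG hyG hyc hP hS h6
  have hb : (((S.erase y).filter (fun x => (S.erase y).erase x ∈ membersIn M (Uq M (4 + 2) 4) G)).card : ℚ) ≤ 3 := by
    exact_mod_cast card_basisPts_le_three_of_two_coloops hG hyG hyc hS h6 hz₁S hz₂S hz₁y hz₂y hz₁₂ hz₁ hz₂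
  have hι := card_r14IdPre_le_one hG hyG hyc hP hS
  have hq0 : (0 : ℚ) ≤ ((G \ S).card : ℚ) := Nat.cast_nonneg _
  have hc0 : (0 : ℚ) ≤ (3 / 35) / (((G \ S).card : ℚ) + 1) := by positivity
  have hcnn : (0 : ℚ) ≤ ((r14CovPre M G S).card : ℚ) := Nat.cast_nonneg _
  -- the pair part
  have hpair : ∑ B ∈ pairPre M 4 G S, r14Pair M G B ≤ 14 / 75 ∨
      (r14CovPre M G S = ∅ ∧ ∑ B ∈ pairPre M 4 G S, r14Pair M G B ≤ 6 / 25) := by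
    by_cases hce : r14CovPre M G S = ∅
    · right
      refine ⟨hce, ?_⟩
      have hp := card_pairPre_le_three_of_two_coloops hG hyG hyc hS h6 hz₁S hz₂S hz₁y hz₂y hz₁₂ hz₁ hz₂
      have hle : ∀ B ∈ pairPre M 4 G S, r14Pair M G B ≤ 2 / 25 :=
        fun B hB => r14Pair_le_of_three_le (three_le_card_sdiff_clF_of_noFar hf hB)
      calc ∑ B ∈ pairPre M 4 G S, r14Pair M G B ≤ ∑ _B ∈ pairPre M 4 G S, (2 : ℚ) / 25 := Finset.sum_le_sum hle
        _ = ((pairPre M 4 G S).card : ℚ) * (2 / 25) := by rw [Finset.sum_const, nsmul_eq_mul]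
        _ ≤ 3 * (2 / 25) := by
            have : ((pairPre M 4 G S).card : ℚ) ≤ 3 := by exact_mod_cast hp
            nlinarith
        _ = 6 / 25 := by norm_num
    · left
      obtain ⟨B, hB⟩ := Finset.nonempty_iff_ne_empty.2 hce
      obtain ⟨z, hzS, hzy, rfl, hz, -⟩ := exists_coloop_of_mem_r14CovPre hG hyG hyc hB
      have hm : S.erase z ∈ membersIn M (Uq M (4 + 2) 4) G := by
        unfold r14CovPre at hB
        exact (mem_coverPreimages.1 (Finset.mem_filter.1 hB).1).1
      rcases eq_or_eq_of_coloop_six hG hsimple hyG hyc hS h6 hz₁S hz₂S hzS hz₁y hz₂y hzy hz₁₂ hz₁ hz₂ hz with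
        rfl | rfl
      · exact sum_r14Pair_le_of_face_member hG hd hsimple hyG hyc hS h6 hf hz₁S hz₂S hz₁y hz₂y hz₁₂ hz₁ hz₂ hm
      · exact sum_r14Pair_le_of_face_member hG hd hsimple hyG hyc hS h6 hf hz₂S hz₁S hz₂y hz₁y hz₁₂.symm hz₂ hz₁ hm
  -- the spread
  have hsp0 : r14Spread M G S ≤ 9 / 35 := by
    have : (3 / 35 : ℚ) / (((G \ S).card : ℚ) + 1) ≤ 3 / 35 := by
      rw [div_le_iff₀ (by positivity)]
      nlinarith
    nlinarith
  rcases Nat.eq_zero_or_pos (r14IdPre M G S).card with h0 | hpos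
  · rw [h0] at hparts
    simp only [Nat.cast_zero, zero_mul, zero_add] at hparts
    rcases hpair with hpair | ⟨hce, hpair⟩
    · nlinarith
    · rw [hce, Finset.sum_empty] at hparts
      linarith
  · obtain ⟨B, hB⟩ := Finset.card_pos.1 hpos
    have hq := three_le_card_sdiff_of_idPre hG hd hyG hyc hP hS hB
    have hsp : r14Spread M G S ≤ 9 / 140 := by
      have hq' : (3 : ℚ) ≤ ((G \ S).card : ℚ) := by exact_mod_cast hq
      have : (3 / 35 : ℚ) / (((G \ S).card : ℚ) + 1) ≤ 3 / 140 := by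
        rw [div_le_iff₀ (by positivity)]
        nlinarith
      nlinarith
    have hι' : ((r14IdPre M G S).card : ℚ) ≤ 1 := by exact_mod_cast hι
    rcases hpair with hpair | ⟨hce, hpair⟩
    · nlinarith
    · rw [hce, Finset.sum_empty] at hparts
      nlinarith

open scoped Classical in
/-- (LI_G) in Case A modulo the six-element columns without a far preimage and with at most one coloop besides `y`. -/
theorem localShadowHall_caseA_of_six_columns_leOneColoop {G : Finset α} (hG : G ∈ flatsQ M (4 + 1))
    (hd : (gr M \ G).card = 2) (hsimple : ∀ e ∈ gr M, ∀ f ∈ gr M, e ≠ f → rkN M {e, f} = 2)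
    (hk : kColoops M G = 1) {y : α} (hyG : y ∈ G) (hyc : y ∉ clF M (G.erase y))
    (hcol6 : ∀ S ∈ shadowAt M (4 + 2) 4 (Uq M (4 + 2) 4) G, S.card = 6 → opFarPre M G S = ∅ →
      (∀ z₁ ∈ S, ∀ z₂ ∈ S, z₁ ≠ y → z₂ ≠ y → z₁ ∉ clF M (S.erase z₁) → z₂ ∉ clF M (S.erase z₂) → z₁ = z₂) →
      ∑ B ∈ membersIn M (Uq M (4 + 2) 4) G, r14W M G B S ≤ 1) :
    LocalShadowHall M 4 G := by
  have hP := four_le_rkN_erase_erase_of_kColoops_eq_one hG hk hyG hyc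
  apply localShadowHall_caseA_of_six_columns_noFar hG hd hsimple hk hyG hyc
  intro S hS h6 hf
  by_cases hone : ∀ z₁ ∈ S, ∀ z₂ ∈ S, z₁ ≠ y → z₂ ≠ y → z₁ ∉ clF M (S.erase z₁) → z₂ ∉ clF M (S.erase z₂) → z₁ = z₂
  · exact hcol6 S hS h6 hf hone
  · push Not at hone
    obtain ⟨z₁, hz₁S, z₂, hz₂S, hz₁y, hz₂y, hz₁, hz₂, hne⟩ := hone
    exact sum_r14W_col_le_of_card_six_of_two_coloops hG hd hsimple hyG hyc hP hS h6 hf hz₁S hz₂S hz₁y hz₂y hne hz₁ hz₂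

section SixFour

variable {α' : Type} [DecidableEq α']

/-- **THE `(6, 4)` SHADOW ROW FOR EVERY FINITE MATROID, MODULO THE SIX-ELEMENT COLUMNS OF R1₄ WITHOUT A FAR
PREIMAGE AND WITH AT MOST ONE COLOOP OF `S` BESIDES `y`** (the cells `κ ≤ 1` of proofs/NIGHT-2-k1.md §7.2–7.4). -/
theorem shadowHall_six_four_of_six_columns_leOneColoop
    (hsix : ∀ (N : Matroid α') [N.Finite], (∀ e ∈ gr N, ∀ f ∈ gr N, e ≠ f → rkN N {e, f} = 2) →
      (∀ e ∈ gr N, N.Indep {e}) → N.eRank = ((6 : ℕ) : ℕ∞) →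
      ∀ G ∈ flatsQ N (4 + 1), (gr N \ G).card = 2 → kColoops N G = 1 →
      ∀ y ∈ G, y ∉ clF N (G.erase y) → 6 ≤ rkN N ((gr N).erase y) →
      ∀ S ∈ shadowAt N (4 + 2) 4 (Uq N (4 + 2) 4) G, S.card = 6 → opFarPre N G S = ∅ →
      (∀ z₁ ∈ S, ∀ z₂ ∈ S, z₁ ≠ y → z₂ ≠ y → z₁ ∉ clF N (S.erase z₁) → z₂ ∉ clF N (S.erase z₂) → z₁ = z₂) →
        ∑ B ∈ membersIn N (Uq N (4 + 2) 4) G, r14W N G B S ≤ 1)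
    (M : Matroid α') [M.Finite] : ShadowHall M 6 4 (phiK 6 4) := by
  apply shadowHall_six_four_of_local_caseA
  intro N _ hs hl hr G hG hd hk y hyG hyc hr6
  exact localShadowHall_caseA_of_six_columns_leOneColoop hG hd hs hk hyG hyc
    (hsix N hs hl hr G hG hd hk y hyG hyc hr6)

end SixFour

end PercRepro.Shadow
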